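import Literature.ModelTheory.Quasiminimal.CrownExtension
import HarnessLib

/-!
# A coherent cosimplicial system of closed self-embeddings of a countable quasiminimal structure

Let `M` be a countable weakly quasiminimal pregeometry structure, `P ⊆ M` a fixed set and
`p, q : ℕ → M` families jointly independent over `P`. The **simplices**
`O_l = cl (P ∪ {q_i : i < l})` are countable closed subsets of `M` (models of the class `𝒦(M)`;
of the same dimension as `M` when `cl P` is infinite dimensional), and an order-preserving
injection `[l] → [l']` should act on them by *relabelling the vertices*. We construct the
generating relabellings — the
**cofaces** `d^j_l : O_l → O_{l+1}` (`j ≤ l`), closed partial embeddings with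
`d^j_l (q_i) = q_i` for `i < j` and `= q_{i+1}` for `i ≥ j` and image
`cl (P ∪ {q_t : t ≤ l, t ≠ j})` — satisfying the **cosimplicial identities**
`d^j_{l+1} ∘ d^i_l = d^i_{l+1} ∘ d^{j-1}_l` (`i < j`). From them one gets a functor from finite
subsets of any linearly ordered set to closed embeddings between the `O_l`, and the direct limit
along a set of cardinality `κ` is a structure of cardinality `max(ℵ₀, κ)` covered by closed
copies of the `O_l`: the existence half of Bays–Hart–Hyttinen–Kesälä–Kirby 2014, Thm 2.3 /
Kirby 2010, Thm 4.2 (`LargeModels.lean`).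

The construction is by recursion on the level `l`, and within a level on the position `j`:
`d^0` comes from Kirby 2010, Thm 2.1, and `d^j` (`j ≥ 1`) is prescribed on the faces
`im d^i_l` (`i < j`) by the identities and is obtained from `CrownExtension.lean`
(`exists_faceMaps_extension`: Kirby's `τ`-trick with Haykazyan's shrinking tails
`cl (P ∪ {p_m : m ≥ n})`, which is why the auxiliary family `p` is needed); the compatibility of the
prescriptions on pairwise intersections of faces is the consistency of the cosimplicial
identities, and uses the identities of the two previous levels.

## Contents

* `cofaceIdx j i` — the coface `δ^j` on indices; its combinatorics.
* `IsCoface L cl P p q n l j f` — `f` is the coface `d^j_l` at tail level `n`.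
* `IsWeaklyQuasiminimalPregeometryStructure.exists_cofaceSystem` — the coherent system.

## References

* J. Kirby, *On quasiminimal excellent classes*, J. Symbolic Logic 75 (2010), Thm 2.1, Thm 3.3
  (proof), Thm 4.2.
* L. Haykazyan, *Categoricity in quasiminimal pregeometry classes*, J. Symbolic Logic 81
  (2016), Thm 16 (proof).
* M. Bays, B. Hart, T. Hyttinen, M. Kesälä, J. Kirby, *Quasiminimal structures and excellence*,
  Bull. LMS 46 (2014), Thm 2.3.
-/

noncomputable section

open Set FirstOrder FirstOrder.Language

universe u v w

namespace Literature.ModelTheory.Quasiminimal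

variable {L : Language.{u, v}} {M : Type w} [L.Structure M] {cl : Set M → Set M}

/-! ### Cofaces on indices -/

section Idx

/-- The coface `δ^j : ℕ → ℕ` on indices: the order-preserving injection skipping `j`.
[folklore] -/
def cofaceIdx (j i : ℕ) : ℕ := if i < j then i else i + 1

/-- `δ^j i = i` below `j`. [folklore] -/
theorem cofaceIdx_of_lt {j i : ℕ} (h : i < j) : cofaceIdx j i = i := if_pos h

/-- `δ^j i = i + 1` from `j` on. [folklore] -/
theorem cofaceIdx_of_le {j i : ℕ} (h : j ≤ i) : cofaceIdx j i = i + 1 := if_neg (not_lt.2 h)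

/-- `δ^0` is the successor. [folklore] -/
theorem cofaceIdx_zero (i : ℕ) : cofaceIdx 0 i = i + 1 := cofaceIdx_of_le (Nat.zero_le i)

/-- `δ^j` never takes the value `j`. [folklore] -/
theorem cofaceIdx_ne (j i : ℕ) : cofaceIdx j i ≠ j := by
  unfold cofaceIdx; split_ifs with h <;> omega

/-- `δ^j` is injective. [folklore] -/
theorem cofaceIdx_injective (j : ℕ) : Function.Injective (cofaceIdx j) := by
  intro a b h; unfold cofaceIdx at h; split_ifs at h <;> omega

/-- `δ^j i ≤ i + 1`. [folklore] -/
theorem cofaceIdx_lt_succ {j i l : ℕ} (h : i < l) : cofaceIdx j i < l + 1 := by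
  unfold cofaceIdx; split_ifs <;> omega

/-- A value `t ≠ j` of the right size is hit by `δ^j` from below `l`. [folklore] -/
theorem exists_cofaceIdx_eq {j t l : ℕ} (htj : t ≠ j) (htl : t < l + 1) (hjl : j ≤ l) :
    ∃ s, s < l ∧ cofaceIdx j s = t := by
  by_cases h : t < j
  · exact ⟨t, by omega, cofaceIdx_of_lt h⟩
  · refine ⟨t - 1, by omega, ?_⟩
    rw [cofaceIdx_of_le (by omega)]; omega

/-- The image of `{i | i < l}` under `δ^j` (`j ≤ l`). [folklore] -/
theorem image_cofaceIdx (j l : ℕ) (hjl : j ≤ l) :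
    cofaceIdx j '' {i | i < l} = {t | t < l + 1 ∧ t ≠ j} := by
  ext t
  simp only [mem_image, mem_setOf_eq]
  constructor
  · rintro ⟨i, hi, rfl⟩
    exact ⟨cofaceIdx_lt_succ hi, cofaceIdx_ne j i⟩
  · rintro ⟨htl, htj⟩
    obtain ⟨s, hs, hst⟩ := exists_cofaceIdx_eq htj htl hjl
    exact ⟨s, hs, hst⟩

/-- **The cosimplicial identity on indices**: `δ^J ∘ δ^i = δ^i ∘ δ^{J-1}` for `i < J`.
[folklore] -/
theorem cofaceIdx_cofaceIdx {i J : ℕ} (hiJ : i < J) (s : ℕ) :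
    cofaceIdx J (cofaceIdx i s) = cofaceIdx i (cofaceIdx (J - 1) s) := by
  unfold cofaceIdx; split_ifs <;> omega

/-- The images `δ^a[{t < l+1} ∖ {b'}] = δ^{b'+1}[{t < l+1} ∖ {a}]` for `a ≤ b'` (both are
`{t < l+2} ∖ {a, b'+1}`). [folklore] -/
theorem image_cofaceIdx_sdiff {a b' l : ℕ} (hab : a ≤ b') (hbl : b' ≤ l) :
    cofaceIdx a '' {t | t < l + 1 ∧ t ≠ b'} = cofaceIdx (b' + 1) '' {t | t < l + 1 ∧ t ≠ a} := by
  ext u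
  simp only [mem_image, mem_setOf_eq]
  constructor
  · rintro ⟨t, ⟨htl, htb⟩, rfl⟩
    by_cases h : t < a
    · refine ⟨t, ⟨htl, by omega⟩, ?_⟩
      rw [cofaceIdx_of_lt (j := a) (i := t) h, cofaceIdx_of_lt (j := b' + 1) (i := t) (by omega)]
    · by_cases h' : t < b'
      · refine ⟨t + 1, ⟨by omega, by omega⟩, ?_⟩
        rw [cofaceIdx_of_le (j := a) (i := t) (by omega),
          cofaceIdx_of_lt (j := b' + 1) (i := t + 1) (by omega)]
      · refine ⟨t, ⟨htl, by omega⟩, ?_⟩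
        rw [cofaceIdx_of_le (j := a) (i := t) (by omega),
          cofaceIdx_of_le (j := b' + 1) (i := t) (by omega)]
  · rintro ⟨t, ⟨htl, hta⟩, rfl⟩
    by_cases h : t < a
    · refine ⟨t, ⟨htl, by omega⟩, ?_⟩
      rw [cofaceIdx_of_lt (j := a) (i := t) h, cofaceIdx_of_lt (j := b' + 1) (i := t) (by omega)]
    · by_cases h' : t < b' + 1
      · refine ⟨t - 1, ⟨by omega, by omega⟩, ?_⟩
        rw [cofaceIdx_of_le (j := a) (i := t - 1) (by omega),
          cofaceIdx_of_lt (j := b' + 1) (i := t) h']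
        omega
      · refine ⟨t, ⟨htl, by omega⟩, ?_⟩
        rw [cofaceIdx_of_le (j := a) (i := t) (by omega),
          cofaceIdx_of_le (j := b' + 1) (i := t) (by omega)]

/-- The image of `{t < l, t ≠ i}` under `δ^{i'}` for `i < i' ≤ l`. [folklore] -/
theorem image_cofaceIdx_sdiff' {i i' l : ℕ} (hii' : i < i') (hi'l : i' ≤ l) :
    cofaceIdx i' '' {t | t < l ∧ t ≠ i} = {u | u < l + 1 ∧ u ≠ i ∧ u ≠ i'} := by
  ext u
  simp only [mem_image, mem_setOf_eq]
  constructor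
  · rintro ⟨t, ⟨htl, hti⟩, rfl⟩
    refine ⟨cofaceIdx_lt_succ htl, ?_, cofaceIdx_ne i' t⟩
    unfold cofaceIdx; split_ifs <;> omega
  · rintro ⟨hul, hui, hui'⟩
    by_cases h : u < i'
    · exact ⟨u, ⟨by omega, hui⟩, cofaceIdx_of_lt h⟩
    · refine ⟨u - 1, ⟨by omega, by omega⟩, ?_⟩
      rw [cofaceIdx_of_le (j := i') (i := u - 1) (by omega)]; omega

end Idx

/-! ### Simplices and cofaces -/

section Coface

variable (L cl)

/-- **The coface `d^j_l` at tail level `n`**: `IsCoface L cl P p q n l j f` says that `f` is a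
partial embedding of the simplex `S^{(n)}_l = cl (P ∪ p[≥ n] ∪ {q_i : i < l})` fixing the tail
`cl (P ∪ p[≥ n])` pointwise, relabelling the vertices by `δ^j` (`q_i ↦ q_{δ^j i}`), with image
the `j`-th face `cl (P ∪ p[≥ n] ∪ {q_t : t ≤ l, t ≠ j})` of `S^{(n)}_{l+1}`. [folklore] -/
structure IsCoface (P : Set M) (p q : ℕ → M) (n l j : ℕ) (f : M → M) : Prop where
  /-- partial embedding on the simplex -/
  isQFEmbOn : IsQFEmbOn L f (cl (P ∪ (p '' {m | n ≤ m} ∪ q '' {i | i < l})))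
  /-- fixes the tail pointwise -/
  fix_tail : ∀ z ∈ cl (P ∪ (p '' {m | n ≤ m})), f z = z
  /-- relabels the vertices by `δ^j` -/
  apply_vertex : ∀ i, i < l → f (q i) = q (cofaceIdx j i)
  /-- image is the `j`-th face of the next simplex -/
  image_eq : f '' cl (P ∪ (p '' {m | n ≤ m} ∪ q '' {i | i < l})) =
    cl (P ∪ (p '' {m | n ≤ m} ∪ q '' (cofaceIdx j '' {i | i < l})))

variable {L cl}

variable {P : Set M} {p q : ℕ → M}

/-- Sub-families of a jointly independent family `(p, q)` are independent over the closure of a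
part of `p`. [folklore] -/
theorem indepFamilyOver_inr (h : IsPregeometry cl) (hpq : IndepFamilyOver cl P (Sum.elim p q))
    (Q : Set ℕ) {ι : Type*} {g : ι → ℕ} (hg : Function.Injective g) :
    IndepFamilyOver cl (cl (P ∪ p '' Q)) (q ∘ g) := by
  intro i hi
  rw [h.cl_cl_union, union_assoc] at hi
  refine hpq (Sum.inr (g i)) (h.mono (union_subset_union_right P ?_) hi)
  rintro _ (⟨m, -, rfl⟩ | ⟨k, hk, rfl⟩)
  · exact ⟨Sum.inl m, (fun hh => by cases hh), rfl⟩
  · exact ⟨Sum.inr (g k), fun hh => hk (hg (Sum.inr_injective hh)), rfl⟩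

/-- Joint independence of `p` with a relabelled sub-family of `q`. [folklore] -/
theorem indepFamilyOver_sumElim_comp (h : IsPregeometry cl)
    (hpq : IndepFamilyOver cl P (Sum.elim p q)) {ι : Type*} {g : ι → ℕ}
    (hg : Function.Injective g) : IndepFamilyOver cl P (Sum.elim p (q ∘ g)) := by
  rintro (m | i) hmem
  · refine hpq (Sum.inl m) (h.mono (union_subset_union_right P ?_) hmem)
    rintro _ ⟨s, hs, rfl⟩
    rcases s with m' | i'
    · exact ⟨Sum.inl m', fun hh => hs (congrArg Sum.inl (Sum.inl_injective hh)), rfl⟩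
    · exact ⟨Sum.inr (g i'), (fun hh => by cases hh), rfl⟩
  · refine hpq (Sum.inr (g i)) (h.mono (union_subset_union_right P ?_) hmem)
    rintro _ ⟨s, hs, rfl⟩
    rcases s with m' | i'
    · exact ⟨Sum.inl m', (fun hh => by cases hh), rfl⟩
    · exact ⟨Sum.inr (g i'), fun hh => hs (congrArg Sum.inr (hg (Sum.inr_injective hh))), rfl⟩

namespace IsCoface

variable {n l j : ℕ} {f : M → M}

/-- The image of a sub-simplex under a coface. [folklore] -/
theorem image_cl (hW : IsWeaklyQuasiminimalPregeometryStructure L M cl)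
    (hf : IsCoface L cl P p q n l j f) {n' : ℕ} (hn : n ≤ n') {I : Set ℕ} (hI : I ⊆ {i | i < l}) :
    f '' cl (P ∪ (p '' {m | n' ≤ m} ∪ q '' I)) =
      cl (P ∪ (p '' {m | n' ≤ m} ∪ q '' (cofaceIdx j '' I))) := by
  have hP := hW.isPregeometry
  have hsub : p '' {m | n' ≤ m} ∪ q '' I ⊆ p '' {m | n ≤ m} ∪ q '' {i | i < l} :=
    union_subset_union (image_mono fun m (hm : n' ≤ m) => hn.trans hm) (image_mono hI)
  have hPfix : ∀ z ∈ P, f z = z := fun z hz => hf.fix_tail z (hP.subset_cl _ (Or.inl hz))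
  have hgen : f '' (P ∪ (p '' {m | n' ≤ m} ∪ q '' I)) =
      P ∪ (p '' {m | n' ≤ m} ∪ q '' (cofaceIdx j '' I)) := by
    rw [image_union, image_union, ← image_comp, ← image_comp, ← image_comp]
    congr 1
    · exact (image_congr fun z hz => hPfix z hz).trans (image_id' P)
    congr 1
    · exact image_congr fun m hm => hf.fix_tail _ (hP.subset_cl _ (Or.inr ⟨m, hn.trans hm, rfl⟩))
    · exact image_congr fun i hi => hf.apply_vertex i (hI hi)
  rw [← hgen]
  refine hf.isQFEmbOn.image_cl_eq hW (hP.mono (union_subset_union_right P hsub)) ?_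
  rw [hgen, hf.image_eq]
  exact hP.mono (union_subset_union_right P (union_subset_union
    (image_mono fun m (hm : n' ≤ m) => hn.trans hm) (image_mono (image_mono hI))))

/-- Cofaces persist when the tail shrinks. [folklore] -/
theorem mono (hW : IsWeaklyQuasiminimalPregeometryStructure L M cl)
    (hf : IsCoface L cl P p q n l j f) {n' : ℕ} (hn : n ≤ n') : IsCoface L cl P p q n' l j f where
  isQFEmbOn := hf.isQFEmbOn.mono (hW.isPregeometry.mono (union_subset_union_right P
    (union_subset_union (image_mono fun m (hm : n' ≤ m) => hn.trans hm) Subset.rfl)))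
  fix_tail z hz := hf.fix_tail z (hW.isPregeometry.mono (union_subset_union_right P
    (image_mono fun m (hm : n' ≤ m) => hn.trans hm)) hz)
  apply_vertex := hf.apply_vertex
  image_eq := hf.image_cl hW hn Subset.rfl

/-- A coface maps the sub-simplex `cl (P ∪ q[I])`, `I ⊆ {i < l}`, onto `cl (P ∪ q[δ^j I])`.
[folklore] -/
theorem image_cl_sub (hW : IsWeaklyQuasiminimalPregeometryStructure L M cl)
    (hf : IsCoface L cl P p q n l j f) {I : Set ℕ} (hI : I ⊆ {i | i < l}) :
    f '' cl (P ∪ (q '' I)) = cl (P ∪ (q '' (cofaceIdx j '' I))) := by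
  have hP := hW.isPregeometry
  have hPfix : ∀ z ∈ P, f z = z := fun z hz => hf.fix_tail z (hP.subset_cl _ (Or.inl hz))
  have hgen : f '' (P ∪ q '' I) = P ∪ q '' (cofaceIdx j '' I) := by
    rw [image_union, ← image_comp, ← image_comp]
    congr 1
    · exact (image_congr fun z hz => hPfix z hz).trans (image_id' P)
    · exact image_congr fun i hi => hf.apply_vertex i (hI hi)
  rw [← hgen]
  refine hf.isQFEmbOn.image_cl_eq hW (hP.mono (union_subset_union_right P
    (subset_union_right.trans' (image_mono hI)))) ?_
  rw [hgen, hf.image_eq]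
  exact hP.mono (union_subset_union_right P (subset_union_right.trans'
    (image_mono (image_mono hI))))

/-- A coface maps the simplex `O_l = cl (P ∪ {q_i : i < l})` onto `cl (P ∪ q[δ^j {i < l}])`.
[folklore] -/
theorem image_cl_vertices (hW : IsWeaklyQuasiminimalPregeometryStructure L M cl)
    (hf : IsCoface L cl P p q n l j f) :
    f '' cl (P ∪ (q '' {i | i < l})) = cl (P ∪ (q '' (cofaceIdx j '' {i | i < l}))) :=
  hf.image_cl_sub hW Subset.rfl

end IsCoface

end Coface

/-! ### Vertex bookkeeping -/

section Vertices

variable {p q : ℕ → M}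

omit [L.Structure M] in
/-- `range (q ∘ val) = q[{t < k}]` on `Fin k`. [folklore] -/
theorem range_comp_val (q : ℕ → M) (k : ℕ) : range (fun t : Fin k => q t) = q '' {t | t < k} := by
  ext y; simp only [mem_range, mem_image, mem_setOf_eq]
  constructor
  · rintro ⟨t, rfl⟩; exact ⟨t, t.isLt, rfl⟩
  · rintro ⟨t, ht, rfl⟩; exact ⟨⟨t, ht⟩, rfl⟩

omit [L.Structure M] in
/-- `range (q ∘ g ∘ val) = q[g[{t < k}]]`. [folklore] -/
theorem range_comp_val' (q : ℕ → M) (g : ℕ → ℕ) (k : ℕ) :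
    range (fun t : Fin k => q (g t)) = q '' (g '' {t | t < k}) := by
  ext y; simp only [mem_range, mem_image, mem_setOf_eq]
  constructor
  · rintro ⟨t, rfl⟩; exact ⟨g t, ⟨t, t.isLt, rfl⟩, rfl⟩
  · rintro ⟨_, ⟨t, ht, rfl⟩, rfl⟩; exact ⟨⟨t, ht⟩, rfl⟩

omit [L.Structure M] in
/-- The vertices other than `i`: `(q ∘ val)[{t ≠ i}] = q[{t < k, t ≠ i}]`. [folklore] -/
theorem image_comp_val_ne (q : ℕ → M) (k : ℕ) (i : Fin k) :
    (fun t : Fin k => q t) '' {t | t ≠ i} = q '' {t | t < k ∧ t ≠ i} := by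
  ext y; simp only [mem_image, mem_setOf_eq]
  constructor
  · rintro ⟨t, ht, rfl⟩; exact ⟨t, ⟨t.isLt, fun h => ht (Fin.ext h)⟩, rfl⟩
  · rintro ⟨t, ⟨htk, hti⟩, rfl⟩; exact ⟨⟨t, htk⟩, fun h => hti (congrArg Fin.val h), rfl⟩

omit [L.Structure M] in
/-- The relabelled vertices other than `i`. [folklore] -/
theorem image_comp_val_ne' (q : ℕ → M) (g : ℕ → ℕ) (k : ℕ) (i : Fin k) :
    (fun t : Fin k => q (g t)) '' {t | t ≠ i} = q '' (g '' {t | t < k ∧ t ≠ i}) := by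
  ext y; simp only [mem_image, mem_setOf_eq]
  constructor
  · rintro ⟨t, ht, rfl⟩; exact ⟨g t, ⟨t, ⟨t.isLt, fun h => ht (Fin.ext h)⟩, rfl⟩, rfl⟩
  · rintro ⟨_, ⟨t, ⟨htk, hti⟩, rfl⟩, rfl⟩
    exact ⟨⟨t, htk⟩, fun h => hti (congrArg Fin.val h), rfl⟩

omit [L.Structure M] in
/-- The vertices other than `i, i'`. [folklore] -/
theorem image_comp_val_ne_ne (q : ℕ → M) (k : ℕ) (i i' : Fin k) :
    (fun t : Fin k => q t) '' {t | t ≠ i ∧ t ≠ i'} = q '' {t | t < k ∧ t ≠ i ∧ t ≠ i'} := by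
  ext y; simp only [mem_image, mem_setOf_eq]
  constructor
  · rintro ⟨t, ⟨ht, ht'⟩, rfl⟩
    exact ⟨t, ⟨t.isLt, fun h => ht (Fin.ext h), fun h => ht' (Fin.ext h)⟩, rfl⟩
  · rintro ⟨t, ⟨htk, hti, hti'⟩, rfl⟩
    exact ⟨⟨t, htk⟩, ⟨fun h => hti (congrArg Fin.val h), fun h => hti' (congrArg Fin.val h)⟩, rfl⟩

end Vertices

/-! ### One more level of cofaces -/

namespace IsWeaklyQuasiminimalPregeometryStructure

variable {P : Set M} {p q : ℕ → M}

/-- **The next level.** Given the cofaces `c j : S_{l-1} → S_l` (`j ≤ l-1`) and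
`d j : S_l → S_{l+1}` (`j ≤ l`) at tail level `n`, satisfying the cosimplicial identities
`d j ∘ c i = d i ∘ c (j-1)` (`i < j`), there are, at some tail level `n' ≥ n`, cofaces
`e j : S_{l+1} → S_{l+2}` (`j ≤ l+1`) satisfying the identities `e j ∘ d i = e i ∘ d (j-1)`
(`i < j`): `e 0` by Kirby 2010 Thm 2.1 and `e j`, `j ≥ 1`, by `exists_faceMaps_extension` with
`e j` prescribed on the face `im (d i)` as `e i ∘ d (j-1) ∘ (d i)⁻¹` for `i < j` (the
compatibility of these prescriptions is the consistency of the cosimplicial identities).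
[cite: Kirby2010QMEC, Thm 3.3 (proof)] [cite: Haykazyan2016, Thm 16 (proof)] -/
theorem exists_next_level [Countable M] (hW : IsWeaklyQuasiminimalPregeometryStructure L M cl)
    (hpq : IndepFamilyOver cl P (Sum.elim p q)) {l n : ℕ} {c d : ℕ → M → M}
    (hd : ∀ j, j ≤ l → IsCoface L cl P p q n l j (d j))
    (hc : ∀ j, j + 1 ≤ l → IsCoface L cl P p q n (l - 1) j (c j))
    (hid : ∀ i j, i < j → j ≤ l → ∀ z ∈ cl (P ∪ (p '' {m | n ≤ m} ∪ q '' {t | t < l - 1})),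
      d j (c i z) = d i (c (j - 1) z)) :
    ∃ n', n ≤ n' ∧ ∃ e : ℕ → M → M, (∀ j, j ≤ l + 1 → IsCoface L cl P p q n' (l + 1) j (e j)) ∧
      ∀ i j, i < j → j ≤ l + 1 → ∀ z ∈ cl (P ∪ (p '' {m | n' ≤ m} ∪ q '' {t | t < l})),
        e j (d i z) = e i (d (j - 1) z) := by
  classical
  have hP := hW.isPregeometry
  haveI : Nonempty M := ⟨p 0⟩
  -- simplices
  set S : ℕ → ℕ → Set M := fun n k => cl (P ∪ (p '' {m | n ≤ m} ∪ q '' {t | t < k})) with hS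
  have hS_mono : ∀ {n n' k k' : ℕ}, n ≤ n' → k' ≤ k → S n' k' ⊆ S n k := fun hn hk =>
    hP.mono (union_subset_union_right P (union_subset_union
      (image_mono fun m (hm : _ ≤ m) => hn.trans hm)
      (image_mono fun t (ht : t < _) => lt_of_lt_of_le ht hk)))
  have hS_cl : ∀ n k, cl (S n k) = S n k := fun n k => hP.cl_cl _
  -- images of cofaces land in the next simplex
  have himS : ∀ {n' k j : ℕ} {f : M → M}, IsCoface L cl P p q n' k j f → j ≤ k →
      ∀ {n''}, n' ≤ n'' → f '' S n'' k ⊆ S n'' (k + 1) := by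
    intro n' k j f hf hjk n'' hn''
    rw [hf.image_cl hW hn'' Subset.rfl, image_cofaceIdx j k hjk]
    exact hP.mono (union_subset_union_right P (union_subset_union_right _
      (image_mono fun t (ht : t < k + 1 ∧ t ≠ j) => ht.1)))
  -- the inner induction on the number `J` of cofaces constructed
  have inner : ∀ J, J ≤ l + 2 → ∃ nJ, n ≤ nJ ∧ ∃ e : ℕ → M → M,
      (∀ j, j < J → IsCoface L cl P p q nJ (l + 1) j (e j)) ∧
      ∀ i j, i < j → j < J → ∀ z ∈ S nJ l, e j (d i z) = e i (d (j - 1) z) := by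
    intro J
    induction J with
    | zero =>
      intro _
      exact ⟨n, le_rfl, fun _ => id, fun j hj => absurd hj (Nat.not_lt_zero j),
        fun i j _ hj => absurd hj (Nat.not_lt_zero j)⟩
    | succ J ih =>
      intro hJ
      obtain ⟨nJ, hnJ, e, he, heid⟩ := ih (Nat.le_of_succ_le hJ)
      have hJl : J ≤ l + 1 := by omega
      rcases Nat.eq_zero_or_pos J with hJ0 | hJpos
      · -- `e 0` from Thm 2.1
        subst hJ0
        set G := cl (P ∪ (p '' {m | nJ ≤ m})) with hG
        have hGcl : cl G = G := hP.cl_cl _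
        let u : Fin (l + 1) → M := fun t => q t
        let u' : Fin (l + 1) → M := fun t => q ((t : ℕ) + 1)
        have hu : IndepFamilyOver cl G u :=
          indepFamilyOver_inr hP hpq _ (g := fun t : Fin (l + 1) => (t : ℕ)) Fin.val_injective
        have hu' : IndepFamilyOver cl (id '' G) u' := by
          rw [image_id]
          exact indepFamilyOver_inr hP hpq _ (g := fun t : Fin (l + 1) => (t : ℕ) + 1)
            (fun a b h => Fin.ext (by simpa using h))
        obtain ⟨F, hF, hFG, hFu, hFim⟩ := hW.exists_isQFEmbOn_extend_indepFamily (f := id)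
          (Or.inl ⟨hGcl, by rw [image_id]; exact hGcl⟩) (IsQFEmbOn.id G) hu hu'
        have hdom : cl (G ∪ range u) = S nJ (l + 1) := by
          rw [hG, hP.cl_cl_union, range_comp_val, union_assoc]
        have him : cl (id '' G ∪ range u') = cl (P ∪ (p '' {m | nJ ≤ m} ∪
            q '' (cofaceIdx 0 '' {t | t < l + 1}))) := by
          have hidx : (· + 1) '' {t | t < l + 1} = cofaceIdx 0 '' {t | t < l + 1} :=
            image_congr fun t _ => (cofaceIdx_zero t).symm
          rw [image_id, hG, hP.cl_cl_union, range_comp_val' q (· + 1), hidx, union_assoc]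
        rw [hdom] at hF
        rw [hdom, him] at hFim
        refine ⟨nJ, hnJ, fun _ => F, fun j hj => ?_, fun i j hij hj => by omega⟩
        have hj0 : j = 0 := by omega
        subst hj0
        exact
          { isQFEmbOn := hF
            fix_tail := fun z hz => hFG hz
            apply_vertex := fun i hi => by
              have := hFu ⟨i, hi⟩; simpa [u, u', cofaceIdx_zero] using this
            image_eq := hFim }
      · -- `e J`, `J ≥ 1`, from the crown extension
        -- vertices
        let x : Fin (l + 1) → M := fun t => q t
        let x' : Fin (l + 1) → M := fun t => q (cofaceIdx J t)
        have hpx : IndepFamilyOver cl P (Sum.elim p x) :=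
          indepFamilyOver_sumElim_comp hP hpq Fin.val_injective
        have hpx' : IndepFamilyOver cl P (Sum.elim p x') :=
          indepFamilyOver_sumElim_comp hP hpq ((cofaceIdx_injective J).comp Fin.val_injective)
        -- cofaces in play, at tail level `nJ`
        have hdi : ∀ i, i ≤ l → IsCoface L cl P p q nJ l i (d i) := fun i hi => (hd i hi).mono hW hnJ
        have hdJ : IsCoface L cl P p q nJ l (J - 1) (d (J - 1)) := hdi _ (by omega)
        -- inverses of the `d i` on `S nJ l`
        let dinv : ℕ → M → M := fun i => Function.invFunOn (d i) (S nJ l)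
        have hdinv : ∀ i, i ≤ l → ∀ z ∈ S nJ l, dinv i (d i z) = z := fun i hi z hz =>
          (hdi i hi).isQFEmbOn.injOn.leftInvOn_invFunOn hz
        -- faces
        have hface : ∀ i : Fin (l + 1), (i : ℕ) ≤ l →
            cl (P ∪ (p '' {m | nJ ≤ m} ∪ x '' {t | t ≠ i})) = d i '' S nJ l := by
          intro i hi
          rw [image_comp_val_ne, (hdi i hi).image_eq, image_cofaceIdx i l hi]
        have hface' : ∀ (i : Fin (l + 1)) (n'), (i : ℕ) ≤ l → nJ ≤ n' →
            cl (P ∪ (p '' {m | n' ≤ m} ∪ x '' {t | t ≠ i})) = d i '' S n' l := by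
          intro i n' hi hn'
          rw [image_comp_val_ne, ((hdi i hi).mono hW hn').image_eq, image_cofaceIdx i l hi]
        -- the prescriptions
        let g : Fin (l + 1) → M → M := fun i z => e i (d (J - 1) (dinv i z))
        have hdJim : d (J - 1) '' S nJ l ⊆ S nJ (l + 1) := himS hdJ (by omega) le_rfl
        have hg_emb : ∀ i : Fin (l + 1), (i : ℕ) < J →
            IsQFEmbOn L (g i) (cl (P ∪ (p '' {m | nJ ≤ m} ∪ x '' {t | t ≠ i}))) := by
          intro i hiJ
          have hil : (i : ℕ) ≤ l := by omega
          rw [hface i hil]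
          have h1 : IsQFEmbOn L (dinv i) (d i '' S nJ l) := (hdi i hil).isQFEmbOn.inverse (hdinv i hil)
          have h1im : dinv i '' (d i '' S nJ l) = S nJ l :=
            ((hdi i hil).isQFEmbOn.injOn.leftInvOn_invFunOn).image_image
          have h2 : IsQFEmbOn L (d (J - 1) ∘ dinv i) (d i '' S nJ l) :=
            h1.comp (by rw [h1im]; exact hdJ.isQFEmbOn)
          exact h2.comp (by
            rw [image_comp, h1im]
            exact (he i hiJ).isQFEmbOn.mono hdJim)
        have hg_val : ∀ i : Fin (l + 1), (i : ℕ) ≤ l → ∀ z ∈ S nJ l, g i (d i z) = e i (d (J - 1) z) := by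
          intro i hil z hz
          change e i (d (J - 1) (dinv i (d i z))) = _
          rw [hdinv i hil z hz]
        have hg_image : ∀ i : Fin (l + 1), (i : ℕ) < J →
            g i '' cl (P ∪ (p '' {m | nJ ≤ m} ∪ x '' {t | t ≠ i})) =
              cl (P ∪ (p '' {m | nJ ≤ m} ∪ x' '' {t | t ≠ i})) := by
          intro i hiJ
          have hil : (i : ℕ) ≤ l := by omega
          rw [hface i hil, ← image_comp]
          have : (g i ∘ d i) '' S nJ l = (e i ∘ d (J - 1)) '' S nJ l :=
            image_congr fun z hz => hg_val i hil z hz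
          rw [this, image_comp, hdJ.image_eq, (he i hiJ).image_cl hW le_rfl (by
              rw [image_cofaceIdx _ _ (by omega : J - 1 ≤ l)]; exact fun t ht => ht.1),
            image_cofaceIdx _ _ (by omega : J - 1 ≤ l),
            image_cofaceIdx_sdiff (a := i) (b' := J - 1) (by omega) (by omega),
            Nat.sub_add_cancel hJpos]
          change _ = cl (P ∪ (p '' {m | nJ ≤ m} ∪ (fun t : Fin (l + 1) => q (cofaceIdx J t)) '' {t | t ≠ i}))
          rw [image_comp_val_ne']
        have hg_tail : ∀ i : Fin (l + 1), (i : ℕ) < J → ∀ z ∈ cl (P ∪ (p '' {m | nJ ≤ m})), g i z = z := by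
          intro i hiJ z hz
          have hil : (i : ℕ) ≤ l := by omega
          have hzS : z ∈ S nJ l := hP.mono (union_subset_union_right P subset_union_left) hz
          have h1 : dinv i z = z := by
            conv_lhs => rw [← (hdi i hil).fix_tail z hz]
            exact hdinv i hil z hzS
          change e i (d (J - 1) (dinv i z)) = z
          rw [h1, hdJ.fix_tail z hz, (he i hiJ).fix_tail z hz]
        have hg_vertex : ∀ i : Fin (l + 1), (i : ℕ) < J → ∀ t : Fin (l + 1), t ≠ i →
            g i (x t) = x' t := by
          intro i hiJ t hti
          have hil : (i : ℕ) ≤ l := by omega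
          obtain ⟨s, hsl, hst⟩ := exists_cofaceIdx_eq (j := i) (t := t) (l := l)
            (fun h => hti (Fin.ext h)) t.isLt hil
          have hqs : q s ∈ S nJ l := hP.subset_cl _ (Or.inr (Or.inr ⟨s, hsl, rfl⟩))
          have hqt : x t = d i (q s) := by
            change q t = _; rw [(hdi i hil).apply_vertex s hsl, hst]
          change e i (d (J - 1) (dinv i (x t))) = q (cofaceIdx J t)
          rw [hqt, hdinv i hil _ hqs, hdJ.apply_vertex s hsl,
            (he i hiJ).apply_vertex _ (cofaceIdx_lt_succ hsl), ← cofaceIdx_cofaceIdx hiJ, hst]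
        have hg_compat_lt : ∀ i i' : Fin (l + 1), (i : ℕ) < i' → (i' : ℕ) < J →
            ∀ z ∈ cl (P ∪ (p '' {m | nJ ≤ m} ∪ x '' {t | t ≠ i ∧ t ≠ i'})), g i z = g i' z := by
          intro i i' hii' hi'J z hz
          have hil : (i : ℕ) ≤ l := by omega
          have hi'l : (i' : ℕ) ≤ l := by omega
          have hl1 : 1 ≤ l := by omega
          -- `z = d i' (c i w)` for some `w ∈ S nJ (l-1)`
          have hcim : c i '' S nJ (l - 1) = cl (P ∪ (p '' {m | nJ ≤ m} ∪ q '' {t | t < l ∧ t ≠ i})) := by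
            rw [((hc i (by omega)).mono hW hnJ).image_eq, image_cofaceIdx i (l - 1) (by omega),
              Nat.sub_add_cancel hl1]
          have hzim : z ∈ d i' '' (c i '' S nJ (l - 1)) := by
            rw [hcim, (hdi i' hi'l).image_cl hW le_rfl (fun t ht => ht.1),
              image_cofaceIdx_sdiff' hii' hi'l]
            rw [image_comp_val_ne_ne] at hz
            exact hz
          obtain ⟨_, ⟨w, hw, rfl⟩, rfl⟩ := hzim
          have hwS : w ∈ cl (P ∪ (p '' {m | n ≤ m} ∪ q '' {t | t < l - 1})) := hS_mono hnJ le_rfl hw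
          have hcw : ∀ j, j + 1 ≤ l → c j w ∈ S nJ l := fun j hj => by
            have := himS ((hc j hj).mono hW hnJ) (by omega) le_rfl (mem_image_of_mem _ hw)
            rwa [Nat.sub_add_cancel hl1] at this
          -- compute both sides
          have lhs : g i (d i' (c i w)) = e i (d (J - 1) (c (i' - 1) w)) := by
            rw [hid i i' hii' hi'l w hwS, hg_val i hil _ (hcw _ (by omega))]
          have rhs : g i' (d i' (c i w)) = e i (d (J - 1) (c (i' - 1) w)) := by
            rw [hg_val i' hi'l _ (hcw _ (by omega)),
              hid i (J - 1) (by omega) (by omega) w hwS,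
              heid i i' hii' hi'J _ (hcw _ (by omega))]
            have := hid (i' - 1) (J - 1) (by omega) (by omega) w hwS
            rw [show J - 1 - 1 = J - 2 from rfl] at this ⊢
            rw [show (i' : ℕ) - 1 = i' - 1 from rfl, this]
          rw [lhs, rhs]
        have hgP : FacePrescriptionOver L cl P p x x' nJ J g :=
          { isQFEmbOn := hg_emb
            image_eq := hg_image
            fix_tail := hg_tail
            apply_vertex := hg_vertex
            compat := fun i i' hiJ hi'J z hz => by
              rcases lt_trichotomy (i : ℕ) i' with h | h | h
              · exact hg_compat_lt i i' h hi'J z hz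
              · have : i = i' := Fin.ext h
                subst this; rfl
              · refine (hg_compat_lt i' i h hiJ z ?_).symm
                exact hP.mono (union_subset_union_right P (union_subset_union_right _ (image_mono
                  fun t (ht : t ≠ i ∧ t ≠ i') => (⟨ht.2, ht.1⟩ : t ≠ i' ∧ t ≠ i)))) hz }
        obtain ⟨m, hm, E, hE, hEg, hEtail, hEx, hEim⟩ :=
          hW.exists_faceMaps_extension_over hpx hpx' hgP hJpos hJl
        rw [range_comp_val] at hE
        rw [range_comp_val, range_comp_val' q (cofaceIdx J)] at hEim
        -- the new family
        let e' : ℕ → M → M := fun j => if j = J then E else e j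
        have he'J : e' J = E := if_pos rfl
        have he'j : ∀ j, j ≠ J → e' j = e j := fun j hj => if_neg hj
        have hEcof : IsCoface L cl P p q m (l + 1) J E :=
          { isQFEmbOn := hE
            fix_tail := hEtail
            apply_vertex := fun i hi => hEx ⟨i, hi⟩
            image_eq := hEim }
        refine ⟨m, hnJ.trans hm, e', fun j hj => ?_, fun i j hij hj z hz => ?_⟩
        · rcases Nat.lt_succ_iff_lt_or_eq.1 hj with hj | hj
          · rw [he'j j (Nat.ne_of_lt hj)]; exact (he j hj).mono hW hm
          · subst hj; rw [he'J]; exact hEcof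
        · have hzS : z ∈ S nJ l := hS_mono hm le_rfl hz
          rcases Nat.lt_succ_iff_lt_or_eq.1 hj with hj | hj
          · rw [he'j j (Nat.ne_of_lt hj), he'j i (by omega)]
            exact heid i j hij hj z hzS
          · subst hj
            have hil : i ≤ l := by omega
            rw [he'J, he'j i (Nat.ne_of_lt hij)]
            have hface_m : d i z ∈ cl (P ∪ (p '' {m' | m ≤ m'} ∪ x '' {t | t ≠ (⟨i, by omega⟩ : Fin (l + 1))})) := by
              rw [hface' ⟨i, by omega⟩ m hil hm]
              exact mem_image_of_mem _ hz
            rw [hEg ⟨i, by omega⟩ hij _ hface_m]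
            exact hg_val ⟨i, by omega⟩ hil z hzS
  obtain ⟨n', hn', e, he, heid⟩ := inner (l + 2) le_rfl
  exact ⟨n', hn', e, fun j hj => he j (Nat.lt_succ_of_le hj),
    fun i j hij hj z hz => heid i j hij (Nat.lt_succ_of_le hj) z hz⟩

/-! ### The recursion on the level -/

/-- The data handed from one level to the next in the construction of the coface system: a
tail level `n`, the cofaces `prev j : S_{l-1} → S_l` and `cur j : S_l → S_{l+1}` with their
cosimplicial identities. [folklore] -/
structure CofaceState (L : Language.{u, v}) {M : Type w} [L.Structure M] (cl : Set M → Set M)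
    (P : Set M) (p q : ℕ → M) (l : ℕ) where
  /-- the tail level -/
  n : ℕ
  /-- the cofaces out of level `l - 1` -/
  prev : ℕ → M → M
  /-- the cofaces out of level `l` -/
  cur : ℕ → M → M
  /-- `cur j` is the `j`-th coface, `j ≤ l` -/
  isCoface_cur : ∀ j, j ≤ l → IsCoface L cl P p q n l j (cur j)
  /-- `prev j` is the `j`-th coface of the previous level, `j ≤ l - 1` -/
  isCoface_prev : ∀ j, j + 1 ≤ l → IsCoface L cl P p q n (l - 1) j (prev j)
  /-- the cosimplicial identities between the two levels -/
  ident : ∀ i j, i < j → j ≤ l → ∀ z ∈ cl (P ∪ (p '' {m | n ≤ m} ∪ q '' {t | t < l - 1})),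
    cur j (prev i z) = cur i (prev (j - 1) z)

/-- Level `0`: the only coface `S_0 → S_1` is the identity on the tail. [folklore] -/
def CofaceState.init (P : Set M) (p q : ℕ → M) : CofaceState L cl P p q 0 where
  n := 0
  prev := fun _ => id
  cur := fun _ => id
  isCoface_cur j hj := by
    have hj0 : j = 0 := Nat.le_zero.1 hj
    subst hj0
    refine ⟨IsQFEmbOn.id _, fun z _ => rfl, fun i hi => absurd hi (Nat.not_lt_zero i), ?_⟩
    rw [image_id]
    congr 2
    simp
  isCoface_prev j hj := absurd hj (by omega)
  ident i j hij hj := absurd (lt_of_lt_of_le hij hj) (Nat.not_lt_zero i)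

/-- The next state (chosen). [folklore] -/
theorem CofaceState.exists_next [Countable M]
    (hW : IsWeaklyQuasiminimalPregeometryStructure L M cl)
    (hpq : IndepFamilyOver cl P (Sum.elim p q)) {l : ℕ} (st : CofaceState L cl P p q l) :
    ∃ st' : CofaceState L cl P p q (l + 1), st'.prev = st.cur ∧ st.n ≤ st'.n := by
  obtain ⟨n', hn', e, he, heid⟩ := hW.exists_next_level hpq st.isCoface_cur st.isCoface_prev st.ident
  exact ⟨⟨n', st.cur, e, he, fun j hj => (st.isCoface_cur j (by omega)).mono hW hn',
    fun i j hij hj z hz => heid i j hij hj z hz⟩, rfl, hn'⟩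

/-- The sequence of states. [folklore] -/
noncomputable def cofaceStates [Countable M] (hW : IsWeaklyQuasiminimalPregeometryStructure L M cl)
    (hpq : IndepFamilyOver cl P (Sum.elim p q)) : (l : ℕ) → CofaceState L cl P p q l
  | 0 => CofaceState.init P p q
  | l + 1 => Classical.choose ((cofaceStates hW hpq l).exists_next hW hpq)

/-- Consecutive states share a level. [folklore] -/
theorem cofaceStates_prev [Countable M] (hW : IsWeaklyQuasiminimalPregeometryStructure L M cl)
    (hpq : IndepFamilyOver cl P (Sum.elim p q)) (l : ℕ) :
    (cofaceStates hW hpq (l + 1)).prev = (cofaceStates hW hpq l).cur :=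
  (Classical.choose_spec ((cofaceStates hW hpq l).exists_next hW hpq)).1

/-- **The coherent coface system** (existence of large models, combinatorial part: Kirby 2010,
Thm 4.2 / BHHKK 2014, Thm 2.3, existence half, via the `τ`-trick of Kirby 2010 Thm 3.3 and
Haykazyan 2016 Thm 16). Let `M` be a countable weakly quasiminimal pregeometry structure and
`p, q : ℕ → M` jointly independent over `P ⊆ M`. Then there are maps `D l j : M → M` (`j ≤ l`)
such that `D l j` is a partial embedding of the simplex `O_l = cl (P ∪ {q_i : i < l})` carrying
each closed sub-simplex `cl (P ∪ q[I])` onto `cl (P ∪ q[δ^j I])` (so `O_l` onto the face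
`cl (P ∪ {q_t : t ≤ l, t ≠ j})` of `O_{l+1}`), relabelling the vertices by `δ^j`, and the
cosimplicial identities
`D (l+1) j ∘ D l i = D (l+1) i ∘ D l (j-1)` (`i < j ≤ l + 1`) hold on `O_l`.
[cite: Kirby2010QMEC, Thm 4.2] -/
theorem exists_cofaceSystem [Countable M] (hW : IsWeaklyQuasiminimalPregeometryStructure L M cl)
    (hpq : IndepFamilyOver cl P (Sum.elim p q)) :
    ∃ D : ℕ → ℕ → M → M,
      (∀ l j, j ≤ l → IsQFEmbOn L (D l j) (cl (P ∪ (q '' {i | i < l})))) ∧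
      (∀ l j (I : Set ℕ), j ≤ l → I ⊆ {i | i < l} →
        D l j '' cl (P ∪ (q '' I)) = cl (P ∪ (q '' (cofaceIdx j '' I)))) ∧
      (∀ l j i, j ≤ l → i < l → D l j (q i) = q (cofaceIdx j i)) ∧
      ∀ l i j, i < j → j ≤ l + 1 → ∀ z ∈ cl (P ∪ (q '' {t | t < l})),
        D (l + 1) j (D l i z) = D (l + 1) i (D l (j - 1) z) := by
  have hP := hW.isPregeometry
  let st := cofaceStates hW hpq
  refine ⟨fun l j => (st l).cur j, fun l j hj => ?_, fun l j I hj hI => ?_, fun l j i hj hi => ?_,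
    fun l i j hij hj z hz => ?_⟩
  · exact ((st l).isCoface_cur j hj).isQFEmbOn.mono
      (hP.mono (union_subset_union_right P subset_union_right))
  · exact ((st l).isCoface_cur j hj).image_cl_sub hW hI
  · exact ((st l).isCoface_cur j hj).apply_vertex i hi
  · have h1 := (st (l + 1)).ident i j hij hj z (by
      rw [Nat.add_sub_cancel]
      exact hP.mono (union_subset_union_right P subset_union_right) hz)
    rw [show (st (l + 1)).prev = (st l).cur from cofaceStates_prev hW hpq l] at h1
    exact h1

end IsWeaklyQuasiminimalPregeometryStructure

end Literature.ModelTheory.Quasiminimal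

end
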